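import Summits.Langlands.Langlands.Theorems.RamifiedCoefficientSeedAdjointLiftingGL3BirthDefs
import Summits.Langlands.Langlands.Theorems.RamifiedCoefficientSeedAdjointLiftingGL3BirthDefs2
import Summits.Langlands.Langlands.Theorems.RamifiedCoefficientSeedAdjointLiftingGL3StubResidualAdjointFormFrame
import Summits.Langlands.Langlands.Theorems.RamifiedCoefficientSeedAdjointLiftingGL3StubResidualAdjointFormIrred
import Summits.Langlands.Langlands.Theorems.RamifiedCoefficientSeedAdjointLiftingGL3StubAdjointResidualImageHelpers
import HarnessLib

/-!
# Stub S1 (`stub_residualAdjointForm`) of crux `AdjointLiftingGL3`, line `birth`: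
# the residual dictionary `τ ≅ η̄ ⊗ ad⁰(τ₀)` in the fixed frame

Crux `stmt-Langlands-16779` = `Summit.Langlands.Langlands.Theses.RamifiedCoefficientSeed.AdjointLiftingGL3`
(line `birth`, skeleton v4, stub S1, registered signature VERBATIM below).  For `p ≥ 5`,
`ρ : Γ_ℚ → GL₃(ℚ̄_p)`, `ρ₀ : Γ_ℚ → GL₂(ℚ̄_p)`, `η : Γ_ℚ → GL₁(ℚ̄_p)` continuous with the seed
congruence `tr ρ ≡ η · (tr ρ₀² / det ρ₀ − 1) (mod 𝔪)` (`AdjointSeed`), and an absolutely irreducible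
residual representation `τ` of `ρ`, the theorem produces a residual representation `τ₀` of `ρ₀`
(finite image) and a reduction `η̄` of `η` with `τ = P (η̄ · Ad(τ₀)) P⁻¹` in the fixed frame
`glAdZeroTwoFrame` (`IsTwistedAdZero τ τ₀ η̄`), and the absolute irreducibility of `ad⁰ τ₀`, on
`Γ_ℚ` and on every subgroup on which `τ` is absolutely irreducible.

Proof (Darmon–Diamond–Taylor §2.1; all steps are tree lemmas):
1. `r₁ := η ⊗ ad⁰ ρ₀` (the accepted `FramedRep.adZeroTwoTwist ρ₀ (det ∘ η)`) has
   `tr r₁ = η₀₀ (tr ρ₀²/det ρ₀ − 1)` (`trace_adZeroTwoTwist`), so `AdjointSeed` reads `tr ρ ≡ tr r₁ (mod 𝔪)`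
   and `τ` is a residual representation of `r₁` (`FramedGaloisRep.IsResidualRepOf.of_trace_congr`,
   `p ≥ 5`).
2. Integral models `ρ₀ᴵ`, `ηᴵ` over `ℤ̄_p` (`exists_integralModel_of_valuationSubring`) give the
   integral model `det ηᴵ · Ad⁰ ρ₀ᴵ` of `r₁` (`isIntegralModelOf_adZeroTwoTwist`), whose reduction
   is `ν = η̄₀₀ · Ad⁰ τ₀` ON THE NOSE (`coe_integralReduction_adZeroTwoTwist`), `τ₀ := ρ₀ᴵ mod 𝔪`,
   `η̄ := ηᴵ mod 𝔪`.
3. `ν` and `τ` have the same characteristic polynomials (both compare to a semisimplification of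
   `ν`, `exists_semisimplification`, `IsResidualRepOf.charpoly_eq`), so `ν` is absolutely
   irreducible (`isAbsIrreducible_of_charpoly_eq`), hence a residual representation of `r₁`, hence
   equivalent to `τ` (Brauer–Nesbitt, `IsResidualRepOf.nonempty_equiv`), hence CONJUGATE to `τ`
   (`exists_conj_of_equiv`): `IsTwistedAdZero τ τ₀ η̄`.
4. `ad⁰ τ₀ = P⁻¹ (η̄⁻¹ · τ) P` inherits absolute irreducibility from `τ`, on `Γ_ℚ` and on subgroups
   (`IsAbsIrreducible.of_conj_smul`); so `τ₀` is irreducible (`isIrreducible_of_isIrreducible_adZero`)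
   and the reduction `τ₀` of `ρ₀` is a residual representation
   (`IsReductionOf.isResidualRepOf_of_isIrreducible`); its image is finite
   (`finite_range_of_isReductionOf`); `η̄` is a reduction of `η` (`Q = 1`).

## References

* [DarmonDiamondTaylor1995] H. Darmon, F. Diamond, R. Taylor, *Fermat's Last Theorem* (1995), §2.1,
  p. 54 and Prop. 2.6 (b).
* [ACCGHLNSTT2023] P. B. Allen et al., *Potential automorphy over CM fields*, §1 (Notation: `ρ̄`),
  Thm. 6.1.1 (5b).
* [BourbakiAlgebreVIII2012] N. Bourbaki, *Algèbre* VIII (2012), § 20 n° 6, Thm. 2, Cor. 1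
  (Brauer–Nesbitt), through `brauerNesbitt_holds`.
-/

set_option linter.dupNamespace false

noncomputable section

namespace Summit.Langlands.Langlands.Cruxes.AdjointLiftingGL3.Birth

open scoped MatrixGroups NumberField Matrix
open NumberField IsDedekindDomain Field Filter
open Literature.NumberTheory.GaloisRepresentations Literature.NumberTheory.PAdicHodge
open Literature.NumberTheory.Automorphic

/-- **S1 — the residual dictionary `τ ≅ η̄ ⊗ ad⁰(τ₀)`** (`p ≥ 5`).  If `tr ρ ≡ η (tr ρ₀²/det ρ₀ − 1)
(mod 𝔪)` (`AdjointSeed`) and `τ` is an absolutely irreducible residual representation of `ρ`, then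
there are a residual representation `τ₀` of `ρ₀` (finite image) and a reduction `η̄` of `η` with
`τ = P (η̄ · Ad(τ₀)) P⁻¹` in the fixed frame (`IsTwistedAdZero`); moreover `ad⁰ τ₀` is absolutely
irreducible, on `Γ_ℚ` and on every subgroup on which `τ` is.  Proof: module docstring (`τ` is a
residual representation of `η ⊗ ad⁰ ρ₀` by the trace congruence; the reduction `η̄ ⊗ ad⁰ τ₀` of its
natural integral model has the characteristic polynomials of `τ`, hence is irreducible and conjugate
to `τ` by Brauer–Nesbitt). [cite: DarmonDiamondTaylor1995, §2.1, p. 54 and Prop. 2.6 (b)]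
[cite: ACCGHLNSTT2023, §1 (Notation)] -/
theorem stub_residualAdjointForm :
    ∀ (p : ℕ) [Fact p.Prime], 5 ≤ p →
      ∀ (ρ : FramedGaloisRep ℚ (PadicAlgCl p) 3) (ρ₀ : FramedGaloisRep ℚ (PadicAlgCl p) 2)
        (η : FramedGaloisRep ℚ (PadicAlgCl p) 1), AdjointSeed p ρ ρ₀ η →
        ∀ τ : absoluteGaloisGroup ℚ →* GL (Fin 3) (padicAlgClResidueField p),
          ρ.IsResidualRepOf (RingHom.id _) τ → IsAbsIrreducible τ →
            ∃ (τ₀ : absoluteGaloisGroup ℚ →* GL (Fin 2) (padicAlgClResidueField p))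
              (ηb : absoluteGaloisGroup ℚ →* GL (Fin 1) (padicAlgClResidueField p)),
              ρ₀.IsResidualRepOf (RingHom.id _) τ₀ ∧ η.IsReductionOf (RingHom.id _) ηb ∧
                (Set.range τ₀).Finite ∧ IsTwistedAdZero τ τ₀ ηb ∧ IsAbsIrreducible (adZeroOf τ₀) ∧
                ∀ H : Subgroup (absoluteGaloisGroup ℚ), IsAbsIrreducible (τ.comp H.subtype) →
                  IsAbsIrreducible ((adZeroOf τ₀).comp H.subtype) := by
  intro p _ hp ρ ρ₀ η hseed τ hτ hirr
  classical
  -- (1) `τ` is a residual representation of `r₁ = η ⊗ ad⁰ ρ₀ = (det ∘ η) · Ad⁰ ρ₀`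
  let χ : absoluteGaloisGroup ℚ →ₜ* (PadicAlgCl p)ˣ :=
    { toMonoidHom := Matrix.GeneralLinearGroup.det.comp
        (η : absoluteGaloisGroup ℚ →* GL (Fin 1) (PadicAlgCl p))
      continuous_toFun := Matrix.GeneralLinearGroup.continuous_det.comp η.continuous }
  have hχ : ∀ σ, ((χ σ : (PadicAlgCl p)ˣ) : PadicAlgCl p) = (η σ).val 0 0 := fun σ =>
    Matrix.det_fin_one _
  let r₁ : FramedGaloisRep ℚ (PadicAlgCl p) 3 := FramedRep.adZeroTwoTwist ρ₀ χ
  have hτ₁ : r₁.IsResidualRepOf (RingHom.id _) τ :=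
    FramedGaloisRep.IsResidualRepOf.of_trace_congr hp ρ r₁ (fun σ => by
      show ‖(ρ σ).val.trace - ((FramedRep.adZeroTwoTwist ρ₀ χ σ : GL (Fin 3) (PadicAlgCl p)) :
        Matrix (Fin 3) (Fin 3) (PadicAlgCl p)).trace‖ < 1
      rw [trace_adZeroTwoTwist, hχ]
      exact hseed σ) hτ
  -- (2) integral models of `ρ₀`, `η`, and of `r₁`; their reductions `τ₀`, `ηb`, `ν`
  obtain ⟨P₀, ρ₀I, hP₀⟩ := exists_integralModel_of_valuationSubring (O := padicAlgClIntegers p)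
    (Valued.isOpen_valuationSubring (PadicAlgCl p)) ρ₀
  obtain ⟨Pη, ηI, hPη⟩ := exists_integralModel_of_valuationSubring (O := padicAlgClIntegers p)
    (Valued.isOpen_valuationSubring (PadicAlgCl p)) η
  have hρ₀I : IsIntegralModelOf (ρ₀ : absoluteGaloisGroup ℚ →* GL (Fin 2) (PadicAlgCl p)) ρ₀I :=
    ⟨P₀, fun g => hP₀ g⟩
  have hηI : IsIntegralModelOf (η : absoluteGaloisGroup ℚ →* GL (Fin 1) (PadicAlgCl p)) ηI :=
    ⟨Pη, fun g => hPη g⟩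
  set τ₀ : absoluteGaloisGroup ℚ →* GL (Fin 2) (padicAlgClResidueField p) :=
    integralReduction (RingHom.id (padicAlgClResidueField p)) ρ₀I with hτ₀def
  set ηb : absoluteGaloisGroup ℚ →* GL (Fin 1) (padicAlgClResidueField p) :=
    integralReduction (RingHom.id (padicAlgClResidueField p)) ηI with hηbdef
  let r₁I : absoluteGaloisGroup ℚ →* GL (Fin 3) (padicAlgClIntegers p) :=
    (FramedRep.adZeroTwoTwistMatrix ρ₀I (Matrix.GeneralLinearGroup.det.comp ηI)).toHomUnits
  set ν : absoluteGaloisGroup ℚ →* GL (Fin 3) (padicAlgClResidueField p) :=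
    integralReduction (RingHom.id (padicAlgClResidueField p)) r₁I with hνdef
  have hτ₀red : ρ₀.IsReductionOf (RingHom.id _) τ₀ :=
    ⟨ρ₀I, 1, hρ₀I, fun g => by rw [inv_one, one_mul, mul_one]⟩
  have hηred : η.IsReductionOf (RingHom.id _) ηb :=
    ⟨ηI, 1, hηI, fun g => by rw [inv_one, one_mul, mul_one]⟩
  have hmodel : IsIntegralModelOf (r₁ : absoluteGaloisGroup ℚ →* GL (Fin 3) (PadicAlgCl p)) r₁I :=
    isIntegralModelOf_adZeroTwoTwist hρ₀I hηI
  have hνred : r₁.IsReductionOf (RingHom.id _) ν :=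
    ⟨r₁I, 1, hmodel, fun g => by rw [inv_one, one_mul, mul_one]⟩
  -- the reduction of the integral model is `ηb₀₀ • Ad⁰ τ₀` on the nose
  have hνmat : ∀ g, ((ν g : GL (Fin 3) (padicAlgClResidueField p)) :
      Matrix (Fin 3) (Fin 3) (padicAlgClResidueField p)) =
      ((((ηb g : GL (Fin 1) (padicAlgClResidueField p)) :
          Matrix (Fin 1) (Fin 1) (padicAlgClResidueField p)) 0 0) •
        ((adZeroOf τ₀ g : GL (Fin 3) (padicAlgClResidueField p)) :
          Matrix (Fin 3) (Fin 3) (padicAlgClResidueField p))) := fun g =>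
    coe_integralReduction_adZeroTwoTwist _ ρ₀I ηI g
  -- (3) `ν` has the characteristic polynomials of `τ`, is absolutely irreducible, conjugate to `τ`
  obtain ⟨ν', hss', hcp', hker'⟩ :=
    Literature.RepresentationTheory.Semisimple.exists_semisimplification ν
  have hν' : r₁.IsResidualRepOf (RingHom.id _) ν' := ⟨ν, hνred, hss', hcp', hker'⟩
  have hcp : ∀ g, ((ν g : GL (Fin 3) (padicAlgClResidueField p)) :
      Matrix (Fin 3) (Fin 3) (padicAlgClResidueField p)).charpoly =
      ((τ g : GL (Fin 3) (padicAlgClResidueField p)) :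
        Matrix (Fin 3) (Fin 3) (padicAlgClResidueField p)).charpoly := fun g =>
    (hcp' g).symm.trans (IsResidualRepOf.charpoly_eq hν' hτ₁ g)
  have hνabs : IsAbsIrreducible ν := isAbsIrreducible_of_charpoly_eq hcp hirr
  have hνres : r₁.IsResidualRepOf (RingHom.id _) ν :=
    IsReductionOf.isResidualRepOf_of_isIrreducible hνred hνabs.isIrreducible_glRepresentation
  obtain ⟨e⟩ := IsResidualRepOf.nonempty_equiv hνres hτ₁
  obtain ⟨P, hP⟩ := exists_conj_of_equiv e
  have hconj : ∀ g, ((τ g : GL (Fin 3) (padicAlgClResidueField p)) :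
      Matrix (Fin 3) (Fin 3) (padicAlgClResidueField p)) =
      (P : Matrix (Fin 3) (Fin 3) (padicAlgClResidueField p)) *
        ((((ηb g : GL (Fin 1) (padicAlgClResidueField p)) :
            Matrix (Fin 1) (Fin 1) (padicAlgClResidueField p)) 0 0) •
          ((adZeroOf τ₀ g : GL (Fin 3) (padicAlgClResidueField p)) :
            Matrix (Fin 3) (Fin 3) (padicAlgClResidueField p))) *
        ((P⁻¹ : GL (Fin 3) (padicAlgClResidueField p)) :
          Matrix (Fin 3) (Fin 3) (padicAlgClResidueField p)) := fun g => by
    rw [hP g, hνmat g]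
  -- (4) conclusions
  have hAd : IsAbsIrreducible (adZeroOf τ₀) := IsAbsIrreducible.of_conj_smul P _ hconj hirr
  have hτ₀irr : (glRepresentation τ₀).IsIrreducible :=
    isIrreducible_of_isIrreducible_adZero τ₀ hAd.isIrreducible_glRepresentation
  refine ⟨τ₀, ηb, IsReductionOf.isResidualRepOf_of_isIrreducible hτ₀red hτ₀irr, hηred,
    finite_range_of_isReductionOf hτ₀red, ⟨P, hconj⟩, hAd, fun H hH => ?_⟩
  exact IsAbsIrreducible.of_conj_smul P
    (fun g : H => (((ηb g : GL (Fin 1) (padicAlgClResidueField p)) :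
      Matrix (Fin 1) (Fin 1) (padicAlgClResidueField p)) 0 0))
    (fun g => hconj g) hH

end Summit.Langlands.Langlands.Cruxes.AdjointLiftingGL3.Birth

end
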